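import Summits.HodgeConjecture.HodgeConjecture.Theorems.R90S9SignedLetterCongrTransport      -- ★ p861691 (this seat): the (d3) engine `cmNonsplitCharIdentityAtTestSigned_transport_formCongr`
import Summits.HodgeConjecture.HodgeConjecture.Theorems.R90S9SimilCongrLocalConstituents      -- ★ p861492 (R90-IF-p02): `comap_comap_symm_cmDatumLocalCongr_mul`, `formCongr_mul_eq_mul_smul_of_formCongr_eq_smul`
import Literature.NumberTheory.Rogawski1990.CharIdentityOnTestFunctionsFormSign                -- ★ `clauseSign_eq_intCast_formSignAt`, `intCast_formSignAt_mul_self`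
import Literature.NumberTheory.Automorphic.UnitaryGroupFormCongrFinSum                          -- ★ `formCongr_one_eq`
import HarnessLib

/-!
# R90-TF · S9 «InnerForm-13.3.6 (c)» — (B3d, d3-pkg-ns) THE NON-SPLIT CLAUSE OF THE SIGNED Q-PACKAGE RIDES THE SIMILITUDE TO THE QUASI-SPLIT MODEL

Cell `hodgecm-mathlib`, crux H413 (`stmt-HodgeConjecture-24833`, lane `--supports`), route of record `HCCMUnconditional` (no route verbs; count-neutral).  Programme
R90-TF (brief `director/R90-BRIEF.v2.md` 1f40d54518340a35), section S9 (base `R90-IF`); seat R90-IF-p03 (g0), RE-DEAL «B3d» (R90-IF-plan (g0), `R90/STATUS.md`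
2026-09-04T15:43:02Z), census `R90/R90-IF-p03/g0/CENSUS-B3d.md` (30fed3dc5b162575) item (d3-pkg-ns).  THEOREMS ONLY, sorry-free, over ★ currency.  HONEST LABEL: HC_CM is
proved only modulo the 7 printed citations (2 remaining named inputs: hLiu418 = stmt-HodgeConjecture-24832, h413 = stmt-HodgeConjecture-24833) until rung 0 closes; this file
proves no printed statement — sign and frame BOOKKEEPING for the transport of print's pinned data [13.1.4, §14.6 p. 242] from `U(H)` to `U(Φ₃)`.

THE MATHEMATICS.  Fix a non-split `v` and the H-FRAME OF THE SIMILITUDE `ᵗ(σT_v)·H_v·T_v = a_v·Φ₃` (census §0: `T_v = B_v⁻¹` for `ᵗB̄ (a•Φ₃) B = H`; transport map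
`e_v⁻¹ : x ↦ T_v⁻¹ x T_v`, Φ₃-side data `D₀ = (Δ‴_{Φ₃}, m_H, e_v⁻¹_* m_G, e_v⁻¹_* ν_G, ν_H)`).  The non-split clause of the SIGNED Q-package ★ `CMCharIdentityClausesTestSigned`
for `H` says: for EVERY H-frame `(T, a)` and Keys labels `(π², πⁿ)` on `U(Φ₃)_v`, the signed letter holds for `πⁿ ∘ e_T⁻¹` with the clause sign `ε(a)`.  The same clause
for `Φ₃` w.r.t. `D₀` asks it for every Φ₃-SELF-frame `(T″, a″)`.  Given `(T″, a″)`, the product `(T_v·T″, a_v·a″)` is an H-frame (★ p02 `formCongr_mul_eq_mul_smul_…`); the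
H-clause there, pushed to the model by the (d3) ENGINE ★ p861691 along `(T_v, a_v)`, is the signed letter w.r.t. `D₀` with sign `χ(a_v)·ε(a_v a″)` for the class
`(πⁿ ∘ e_{T_vT″}⁻¹) ∘ e_v = πⁿ ∘ e_{T″}⁻¹` (★ p02 `comap_comap_symm_cmDatumLocalCongr_mul`).  SIGN CONSTANCY: every H-frame has clause sign `ε_v(H)` and every Φ₃-frame
has clause sign `ε_v(Φ₃)` (★ `clauseSign_eq_intCast_formSignAt`, LH7's «`a ≡ −det` mod norms»), and `ε_v(Φ₃) = 1` (identity frame); so `χ(a_v)·ε(a_v a″) = ε_v(H)² = 1 = ε(a″)`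
[Rogawski1990 §14.6 p. 242: the product of the local signs; LanglandsShelstad1987 §1].

* §1 `intCast_formSignAt_antidiag_eq_one` — `ε_v(Φ₃) = 1` at a non-split `v`; `clauseSign_antidiag_frame_eq_one` — every Φ₃-self-frame has clause sign `1`;
  `intCast_clauseSign_mul_clauseSign_eq` — `χ(a_v)·ε(a_v a″) = ε(a″)` for an H-frame `(T_v, a_v)`, the product H-frame and the Φ₃-frame `(T″, a″)`.
* §2 **`cmNonsplitClause_transport_formCongr`** — the non-split clause at `v` of the signed package for `H` (data `D`) implies the non-split clause at `v` for `Φ₃` (data `D₀`).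
* §3 `charIdentityAtTestSigned_pair_transport_formCongr` — WITNESS LEVEL: a named signed Test-completion `⟨πⁿ, πˢ⟩` at `D` rides to `⟨πⁿ ∘ e, πˢ ∘ e⟩` at `D₀` (sign `χ(a)·ε`);
  what the glue feeds to ★ p861411 `eq_of_charIdentityAtTestSigned` on the model to read the transported package's `.πs` back (census §2, third disjunct).

## References
* [Rogawski1990] J. D. Rogawski, *Automorphic Representations of Unitary Groups in Three Variables*, Ann. of Math. Stud. 123 (1990): §13.1 Prop. 13.1.4 p. 199; §4.9 p. 55;
  §14.2 p. 232; §14.6 p. 242.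
* [LanglandsShelstad1987] R. P. Langlands, D. Shelstad, *On the definition of transfer factors*, Math. Ann. 278 (1987): §1, §4.2.
-/

set_option autoImplicit false
-- the mandated namespace repeats `HodgeConjecture.HodgeConjecture`, as in every `Theorems/*.lean` of this sub-problem
set_option linter.dupNamespace false

noncomputable section

open NumberField IsDedekindDomain MeasureTheory MeasureTheory.Measure
open scoped Matrix MatrixGroups
open Literature.NumberTheory.Rogawski1990 Literature.NumberTheory.Automorphic Literature.NumberTheory.Automorphic.UnitaryGroup
open Literature.NumberTheory.GaloisRepresentations
open Summit.HodgeConjecture.HodgeConjecture.Cruxes.H413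

namespace Summit.HodgeConjecture.HodgeConjecture.R90.S9

/-! ## §1 Sign constancy: H-frames have clause sign `ε_v(H)`, Φ₃-frames have clause sign `1` -/

section Sign

variable (L : Type) [Field L] [NumberField L] [IsCMField L] (H : Matrix (Fin 3) (Fin 3) L)
  (v : HeightOneSpectrum (𝓞 ↥(maximalRealSubfield L)))

open scoped Classical in
/-- **`ε_v(Φ₃) = 1` at a non-split `v`**: the identity frame `ᵗσ1 · Φ₃ · 1 = 1 · Φ₃` has multiplier `1 = 1 · σ 1`, a unit norm, so its clause sign is `1`; by ★
`clauseSign_eq_intCast_formSignAt` that sign is `formSignAt L c Φ₃ v`. [cite: Rogawski1990, §14.6 p. 242] [cite: LanglandsShelstad1987, §1] -/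
theorem intCast_formSignAt_antidiag_eq_one (hns : ∀ w : PlacesOver L v, IsCMField.complexConj L • w.1 = w.1) :
    ((formSignAt L (IsCMField.complexConj L) (Matrix.of fun i j : Fin 3 => if i.val + j.val + 1 = 3 then (1 : L) else 0) v : ℤ) : ℂ) = 1 := by
  have h1 : formCongr (conjLocal L (IsCMField.complexConj L) v) (1 : GL (Fin 3) (LocalRing L v))
      ((Matrix.of fun i j : Fin 3 => if i.val + j.val + 1 = 3 then (1 : L) else 0).map (algebraMap L (LocalRing L v))) =
      (1 : LocalRing L v) • (Matrix.of fun i j : Fin 3 => if i.val + j.val + 1 = 3 then (1 : L) else 0).map (algebraMap L (LocalRing L v)) := by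
    rw [formCongr_one_eq, one_smul]
  rw [← clauseSign_eq_intCast_formSignAt L (Matrix.of fun i j : Fin 3 => if i.val + j.val + 1 = 3 then (1 : L) else 0) (antidiagOne_isHermitian L 3) v hns 1 1
    isUnit_one h1]
  have hex : ∃ z : LocalRing L v, IsUnit z ∧ (1 : LocalRing L v) = z * conjLocal L (IsCMField.complexConj L) v z :=
    ⟨1, isUnit_one, by rw [map_one, one_mul]⟩
  rw [if_pos hex]

open scoped Classical in
/-- **Every Φ₃-self-frame has clause sign `1`** at a non-split `v`: `ε(a″) = ε_v(Φ₃) = 1` for `ᵗσT″ · Φ₃ · T″ = a″ · Φ₃`. [cite: Rogawski1990, §14.6 p. 242] [cite: LanglandsShelstad1987, §1] -/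
theorem clauseSign_antidiag_frame_eq_one (hns : ∀ w : PlacesOver L v, IsCMField.complexConj L • w.1 = w.1)
    (T'' : GL (Fin 3) (LocalRing L v)) (a'' : LocalRing L v) (ha'' : IsUnit a'')
    (h'' : formCongr (conjLocal L (IsCMField.complexConj L) v) T''
        ((Matrix.of fun i j : Fin 3 => if i.val + j.val + 1 = 3 then (1 : L) else 0).map (algebraMap L (LocalRing L v))) =
      a'' • (Matrix.of fun i j : Fin 3 => if i.val + j.val + 1 = 3 then (1 : L) else 0).map (algebraMap L (LocalRing L v))) :
    (if ∃ z : LocalRing L v, IsUnit z ∧ a'' = z * conjLocal L (IsCMField.complexConj L) v z then (1 : ℂ) else -1) = 1 := by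
  rw [clauseSign_eq_intCast_formSignAt L (Matrix.of fun i j : Fin 3 => if i.val + j.val + 1 = 3 then (1 : L) else 0) (antidiagOne_isHermitian L 3) v hns T'' a''
    ha'' h'', intCast_formSignAt_antidiag_eq_one L v hns]

open scoped Classical in
/-- **Sign constancy across the similitude**: for an H-frame `(T_v, a_v)` (clause sign `χ(a_v)`, here in the `ℤ`-cast spelling of ★ `isLocalDeltaTransfer_iff_of_formCongr`), the
product H-frame `(T_v·T″, a_v·a″)` (clause sign `ε(a_v a″)`) and the Φ₃-self-frame `(T″, a″)`: `χ(a_v) · ε(a_v a″) = ε(a″)` — both H-signs are `ε_v(H)` (★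
`clauseSign_eq_intCast_formSignAt`), `ε_v(H)² = 1` (★ `intCast_formSignAt_mul_self`), and `ε(a″) = 1` (§1). [cite: Rogawski1990, §14.6 p. 242] [cite: LanglandsShelstad1987, §1] -/
theorem intCast_clauseSign_mul_clauseSign_eq (hH : (H.map (cmConjRingHom L))ᵀ = H)
    (hns : ∀ w : PlacesOver L v, IsCMField.complexConj L • w.1 = w.1)
    (Tᵥ : GL (Fin 3) (LocalRing L v)) (aᵥ : LocalRing L v) (haᵥ : IsUnit aᵥ)
    (hᵥ : formCongr (conjLocal L (IsCMField.complexConj L) v) Tᵥ (H.map (algebraMap L (LocalRing L v))) =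
      aᵥ • (Matrix.of fun i j : Fin 3 => if i.val + j.val + 1 = 3 then (1 : L) else 0).map (algebraMap L (LocalRing L v)))
    (T'' : GL (Fin 3) (LocalRing L v)) (a'' : LocalRing L v) (ha'' : IsUnit a'')
    (h'' : formCongr (conjLocal L (IsCMField.complexConj L) v) T''
        ((Matrix.of fun i j : Fin 3 => if i.val + j.val + 1 = 3 then (1 : L) else 0).map (algebraMap L (LocalRing L v))) =
      a'' • (Matrix.of fun i j : Fin 3 => if i.val + j.val + 1 = 3 then (1 : L) else 0).map (algebraMap L (LocalRing L v)))
    (hcomp : formCongr (conjLocal L (IsCMField.complexConj L) v) (Tᵥ * T'') (H.map (algebraMap L (LocalRing L v))) =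
      (aᵥ * a'') • (Matrix.of fun i j : Fin 3 => if i.val + j.val + 1 = 3 then (1 : L) else 0).map (algebraMap L (LocalRing L v))) :
    (((if ∃ z : LocalRing L v, IsUnit z ∧ aᵥ = z * conjLocal L (IsCMField.complexConj L) v z then (1 : ℤ) else -1 : ℤ) : ℂ)) *
        (if ∃ z : LocalRing L v, IsUnit z ∧ aᵥ * a'' = z * conjLocal L (IsCMField.complexConj L) v z then (1 : ℂ) else -1) =
      (if ∃ z : LocalRing L v, IsUnit z ∧ a'' = z * conjLocal L (IsCMField.complexConj L) v z then (1 : ℂ) else -1) := by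
  have hcast : (((if ∃ z : LocalRing L v, IsUnit z ∧ aᵥ = z * conjLocal L (IsCMField.complexConj L) v z then (1 : ℤ) else -1 : ℤ) : ℂ)) =
      (if ∃ z : LocalRing L v, IsUnit z ∧ aᵥ = z * conjLocal L (IsCMField.complexConj L) v z then (1 : ℂ) else -1) := by
    split_ifs <;> simp
  rw [hcast, clauseSign_eq_intCast_formSignAt L H hH v hns Tᵥ aᵥ haᵥ hᵥ,
    clauseSign_eq_intCast_formSignAt L H hH v hns (Tᵥ * T'') (aᵥ * a'') (haᵥ.mul ha'') hcomp, intCast_formSignAt_mul_self,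
    clauseSign_antidiag_frame_eq_one L v hns T'' a'' ha'' h'']

end Sign

/-! ## §2 The non-split clause of the signed package rides the similitude -/

section Clause

variable (L : Type) [Field L] [NumberField L] [IsCMField L] (H : Matrix (Fin 3) (Fin 3) L)
  (v : HeightOneSpectrum (𝓞 ↥(maximalRealSubfield L)))

open scoped Classical in
set_option synthInstance.maxHeartbeats 400000 in
set_option maxHeartbeats 4000000 in
/-- **(B3d, d3-pkg-ns) THE NON-SPLIT CLAUSE OF THE SIGNED Q-PACKAGE RIDES THE SIMILITUDE TO THE QUASI-SPLIT MODEL.**  At a non-split `v`, for a hermitian `H` with unit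
determinant and the H-frame of the similitude `ᵗ(σT_v)·H_v·T_v = a_v·Φ₃` (`e_v := cmDatumLocalCongr L v T_v ha_v h_v`): IF for every H-frame `(T, a)` and all Keys labels
`(π², πⁿ)` (`πⁿ` not `L²`) the SIGNED letter holds on `U(H)_v` for `πⁿ ∘ e_T⁻¹` with the clause sign `ε(a)` at the data `D = (Δ‴_H, m_H, m_G, ν_G, ν_H, ξ_v)` — the `v`-th
non-split conjunct of ★ `CMCharIdentityClausesTestSigned` for `H` — THEN for every Φ₃-self-frame `(T″, a″)` and the same labels the signed letter holds on `U(Φ₃)_v` for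
`πⁿ ∘ e_{T″}⁻¹` with the clause sign `ε(a″)` at the transported data `D₀ = (Δ‴_{Φ₃}, m_H, e_v⁻¹_* m_G, e_v⁻¹_* ν_G, ν_H, ξ_v)` — the `v`-th non-split conjunct for `Φ₃`.
Proof: product frame `(T_v·T″, a_v·a″)`, the (d3) engine ★ p861691 along `(T_v, a_v)`, the class law ★ p02 `comap_comap_symm_cmDatumLocalCongr_mul`, and §1's sign constancy.
[cite: Rogawski1990, §13.1 Prop. 13.1.4 p. 199; §14.2 p. 232; §14.6 p. 242] [cite: LanglandsShelstad1987, §1, §4.2] -/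
theorem cmNonsplitClause_transport_formCongr (μ : HeckeCharacter L)
    (w : PlacesOver L v) (hw : IsCMField.complexConj L • w.1 = w.1) (hns : ∀ w : PlacesOver L v, IsCMField.complexConj L • w.1 = w.1)
    (hH : (H.map (cmConjRingHom L))ᵀ = H) (hHd : IsUnit H.det)
    (Tᵥ : GL (Fin 3) (UnitaryGroup.LocalRing L v)) {aᵥ : UnitaryGroup.LocalRing L v} (haᵥ : IsUnit aᵥ)
    (haσ : conjLocal L (IsCMField.complexConj L) v aᵥ = aᵥ)
    (hᵥ : formCongr (conjLocal L (IsCMField.complexConj L) v) Tᵥ (H.map (algebraMap L (UnitaryGroup.LocalRing L v))) =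
      aᵥ • (Matrix.of fun i j : Fin 3 => if i.val + j.val + 1 = 3 then (1 : L) else 0).map (algebraMap L (UnitaryGroup.LocalRing L v)))
    [MeasurableSpace ((UnitaryGroup.cmDatum L 3 H).Local v)] [BorelSpace ((UnitaryGroup.cmDatum L 3 H).Local v)]
    [MeasurableSpace ((UnitaryGroup.cmDatum L 3 (Matrix.of fun i j : Fin 3 => if i.val + j.val + 1 = 3 then (1 : L) else 0)).Local v)]
    [BorelSpace ((UnitaryGroup.cmDatum L 3 (Matrix.of fun i j : Fin 3 => if i.val + j.val + 1 = 3 then (1 : L) else 0)).Local v)]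
    [∀ γ : (UnitaryGroup.cmDatum L 3 H).Local v, MeasurableSpace (((UnitaryGroup.cmDatum L 3 H).Local v) ⧸ Subgroup.centralizer ({γ} : Set ((UnitaryGroup.cmDatum L 3 H).Local v)))]
    [∀ γ : (UnitaryGroup.cmDatum L 3 H).Local v, BorelSpace (((UnitaryGroup.cmDatum L 3 H).Local v) ⧸ Subgroup.centralizer ({γ} : Set ((UnitaryGroup.cmDatum L 3 H).Local v)))]
    [∀ γ : (UnitaryGroup.cmDatum L 3 (Matrix.of fun i j : Fin 3 => if i.val + j.val + 1 = 3 then (1 : L) else 0)).Local v,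
      MeasurableSpace (((UnitaryGroup.cmDatum L 3 (Matrix.of fun i j : Fin 3 => if i.val + j.val + 1 = 3 then (1 : L) else 0)).Local v) ⧸
        Subgroup.centralizer ({γ} : Set ((UnitaryGroup.cmDatum L 3 (Matrix.of fun i j : Fin 3 => if i.val + j.val + 1 = 3 then (1 : L) else 0)).Local v)))]
    [∀ γ : (UnitaryGroup.cmDatum L 3 (Matrix.of fun i j : Fin 3 => if i.val + j.val + 1 = 3 then (1 : L) else 0)).Local v,
      BorelSpace (((UnitaryGroup.cmDatum L 3 (Matrix.of fun i j : Fin 3 => if i.val + j.val + 1 = 3 then (1 : L) else 0)).Local v) ⧸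
        Subgroup.centralizer ({γ} : Set ((UnitaryGroup.cmDatum L 3 (Matrix.of fun i j : Fin 3 => if i.val + j.val + 1 = 3 then (1 : L) else 0)).Local v)))]
    [MeasurableSpace ((UnitaryGroup.cmDatum L 2 (Matrix.of fun i j : Fin 2 => if i.val + j.val + 1 = 2 then (1 : L) else 0)).Local v ×
      (UnitaryGroup.cmDatum L 1 (Matrix.of fun i j : Fin 1 => if i.val + j.val + 1 = 1 then (1 : L) else 0)).Local v)]
    [∀ a' : (UnitaryGroup.cmDatum L 2 (Matrix.of fun i j : Fin 2 => if i.val + j.val + 1 = 2 then (1 : L) else 0)).Local v ×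
        (UnitaryGroup.cmDatum L 1 (Matrix.of fun i j : Fin 1 => if i.val + j.val + 1 = 1 then (1 : L) else 0)).Local v,
      MeasurableSpace (((UnitaryGroup.cmDatum L 2 (Matrix.of fun i j : Fin 2 => if i.val + j.val + 1 = 2 then (1 : L) else 0)).Local v ×
          (UnitaryGroup.cmDatum L 1 (Matrix.of fun i j : Fin 1 => if i.val + j.val + 1 = 1 then (1 : L) else 0)).Local v) ⧸
        Subgroup.centralizer ({a'} : Set ((UnitaryGroup.cmDatum L 2 (Matrix.of fun i j : Fin 2 => if i.val + j.val + 1 = 2 then (1 : L) else 0)).Local v ×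
          (UnitaryGroup.cmDatum L 1 (Matrix.of fun i j : Fin 1 => if i.val + j.val + 1 = 1 then (1 : L) else 0)).Local v)))]
    (mHv : OrbitalMeasureFamily ((UnitaryGroup.cmDatum L 2 (Matrix.of fun i j : Fin 2 => if i.val + j.val + 1 = 2 then (1 : L) else 0)).Local v ×
      (UnitaryGroup.cmDatum L 1 (Matrix.of fun i j : Fin 1 => if i.val + j.val + 1 = 1 then (1 : L) else 0)).Local v))
    (mGv : OrbitalMeasureFamily ((UnitaryGroup.cmDatum L 3 H).Local v))
    (νG : Measure ((UnitaryGroup.cmDatum L 3 H).Local v)) [νG.IsHaarMeasure]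
    (νH : Measure ((UnitaryGroup.cmDatum L 2 (Matrix.of fun i j : Fin 2 => if i.val + j.val + 1 = 2 then (1 : L) else 0)).Local v ×
      (UnitaryGroup.cmDatum L 1 (Matrix.of fun i j : Fin 1 => if i.val + j.val + 1 = 1 then (1 : L) else 0)).Local v))
    (ξ : OneDimAutRepH L)
    -- the `v`-th non-split conjunct of ★ `CMCharIdentityClausesTestSigned` for `H` at `ξ.xiLocalChar v` (data `D`)
    (hclause : ∀ (T : GL (Fin 3) (UnitaryGroup.LocalRing L v)) (a : UnitaryGroup.LocalRing L v) (ha : IsUnit a)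
      (h : formCongr (conjLocal L (IsCMField.complexConj L) v) T (H.map (algebraMap L (UnitaryGroup.LocalRing L v))) =
        a • (Matrix.of fun i j : Fin 3 => if i.val + j.val + 1 = 3 then (1 : L) else 0).map (algebraMap L (UnitaryGroup.LocalRing L v))),
      ∀ [MeasurableSpace (Gqs L v ⧸ Subgroup.center (Gqs L v))] [BorelSpace (Gqs L v ⧸ Subgroup.center (Gqs L v))]
        (μZ : Measure (Gqs L v ⧸ Subgroup.center (Gqs L v))) [μZ.IsHaarMeasure],
      ∀ (π2 πn : IrrClass (Gqs L v)),
        KeysCaseTwoLabels L v (μ.semilocalComponent L v) (torusLocalComponent L (IsCMField.complexConj L) v ξ.η)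
          (torusLocalComponent L (IsCMField.complexConj L) v ξ.ψ) π2 πn →
        ¬ πn.IsSquareIntegrable μZ →
        CMNonsplitCharIdentityAtTestSigned L v H
          ((finExplicitCollection L H μ (finExplicitDelta_conj_left_all L H μ) (finExplicitDelta_conj_right_all L H μ)) v) mHv mGv νG νH (ξ.xiLocalChar v)
          (if ∃ z : UnitaryGroup.LocalRing L v, IsUnit z ∧ a = z * conjLocal L (IsCMField.complexConj L) v z then (1 : ℂ) else -1)
          (IrrClass.comap (cmDatumLocalCongr L v T ha h).symm πn)) :
    -- the `v`-th non-split conjunct for `Φ₃` at `ξ.xiLocalChar v` (data `D₀`)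
    ∀ (T'' : GL (Fin 3) (UnitaryGroup.LocalRing L v)) (a'' : UnitaryGroup.LocalRing L v) (ha'' : IsUnit a'')
      (h'' : formCongr (conjLocal L (IsCMField.complexConj L) v) T''
          ((Matrix.of fun i j : Fin 3 => if i.val + j.val + 1 = 3 then (1 : L) else 0).map (algebraMap L (UnitaryGroup.LocalRing L v))) =
        a'' • (Matrix.of fun i j : Fin 3 => if i.val + j.val + 1 = 3 then (1 : L) else 0).map (algebraMap L (UnitaryGroup.LocalRing L v))),
      ∀ [MeasurableSpace (Gqs L v ⧸ Subgroup.center (Gqs L v))] [BorelSpace (Gqs L v ⧸ Subgroup.center (Gqs L v))]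
        (μZ : Measure (Gqs L v ⧸ Subgroup.center (Gqs L v))) [μZ.IsHaarMeasure],
      ∀ (π2 πn : IrrClass (Gqs L v)),
        KeysCaseTwoLabels L v (μ.semilocalComponent L v) (torusLocalComponent L (IsCMField.complexConj L) v ξ.η)
          (torusLocalComponent L (IsCMField.complexConj L) v ξ.ψ) π2 πn →
        ¬ πn.IsSquareIntegrable μZ →
        CMNonsplitCharIdentityAtTestSigned L v (Matrix.of fun i j : Fin 3 => if i.val + j.val + 1 = 3 then (1 : L) else 0)
          ((finExplicitCollection L (Matrix.of fun i j : Fin 3 => if i.val + j.val + 1 = 3 then (1 : L) else 0) μ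
            (finExplicitDelta_conj_left_all L (Matrix.of fun i j : Fin 3 => if i.val + j.val + 1 = 3 then (1 : L) else 0) μ)
            (finExplicitDelta_conj_right_all L (Matrix.of fun i j : Fin 3 => if i.val + j.val + 1 = 3 then (1 : L) else 0) μ)) v) mHv
          (mGv.transport (cmDatumLocalCongr L v Tᵥ haᵥ hᵥ).symm.toMulEquiv (cmDatumLocalCongr L v Tᵥ haᵥ hᵥ).symm.continuous
            (cmDatumLocalCongr L v Tᵥ haᵥ hᵥ).continuous)
          (νG.map (cmDatumLocalCongr L v Tᵥ haᵥ hᵥ).symm) νH (ξ.xiLocalChar v)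
          (if ∃ z : UnitaryGroup.LocalRing L v, IsUnit z ∧ a'' = z * conjLocal L (IsCMField.complexConj L) v z then (1 : ℂ) else -1)
          (IrrClass.comap (cmDatumLocalCongr L v T'' ha'' h'').symm πn) := by
  intro T'' a'' ha'' h'' _ _ μZ _ π2 πn hK hn
  -- the product H-frame `(T_v·T″, a_v·a″)`
  have hcomp : formCongr (conjLocal L (IsCMField.complexConj L) v) (Tᵥ * T'') (H.map (algebraMap L (UnitaryGroup.LocalRing L v))) =
      (aᵥ * a'') • (Matrix.of fun i j : Fin 3 => if i.val + j.val + 1 = 3 then (1 : L) else 0).map (algebraMap L (UnitaryGroup.LocalRing L v)) :=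
    formCongr_mul_eq_mul_smul_of_formCongr_eq_smul L v T'' Tᵥ h'' hᵥ
  have hId := hclause (Tᵥ * T'') (aᵥ * a'') (haᵥ.mul ha'') hcomp μZ π2 πn hK hn
  -- the (d3) engine along the similitude frame
  have hT := cmNonsplitCharIdentityAtTestSigned_transport_formCongr L H v μ w hw hH hHd Tᵥ haᵥ haσ hᵥ mHv mGv νG νH (ξ.xiLocalChar v) _ _ hId
  -- the class law and the sign law
  rw [comap_comap_symm_cmDatumLocalCongr_mul L v T'' Tᵥ ha'' haᵥ (haᵥ.mul ha'') h'' hᵥ hcomp πn,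
    intCast_clauseSign_mul_clauseSign_eq L H v hH hns Tᵥ aᵥ haᵥ hᵥ T'' a'' ha'' h'' hcomp] at hT
  exact hT

end Clause

/-! ## §3 Witness level: a signed Test-completion rides the similitude (the form the glue's uniqueness call consumes) -/

section Pair

variable (L : Type) [Field L] [NumberField L] [IsCMField L] (H : Matrix (Fin 3) (Fin 3) L)
  (v : HeightOneSpectrum (𝓞 ↥(maximalRealSubfield L)))

open scoped Classical in
set_option synthInstance.maxHeartbeats 400000 in
set_option maxHeartbeats 4000000 in
/-- **(B3d, witness level) A SIGNED TEST-COMPLETION RIDES THE FRAME.**  Same setting as the (d3) engine ★ `cmNonsplitCharIdentityAtTestSigned_transport_formCongr`, but for a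
NAMED partner: if the packet `⟨πⁿ, some πˢ⟩` of `U(H)_v` satisfies the signed (13.1.4) on test functions at `D = (Δ‴_H, m_H, m_G, ν_G, ν_H, ξ_v)` with sign `ε`, then
`⟨πⁿ ∘ e, some (πˢ ∘ e)⟩` satisfies it on `U(Φ₃)_v` at `D₀ = (Δ‴_{Φ₃}, m_H, e⁻¹_* m_G, e⁻¹_* ν_G, ν_H, ξ_v)` with sign `χ(a)·ε` (`e = cmDatumLocalCongr L v T ha h`).  This is the
statement the B3 glue feeds to ★ p861411 `eq_of_charIdentityAtTestSigned` on the model to read the `.πs` of the transported package back (census §2).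
[cite: Rogawski1990, §13.1 Prop. 13.1.3 (d), Prop. 13.1.4 p. 199; §4.3 (4.3.1)–(4.3.2) p. 43; §14.4 p. 237] [cite: LanglandsShelstad1987, §4.2] -/
theorem charIdentityAtTestSigned_pair_transport_formCongr (μ : HeckeCharacter L)
    (w : PlacesOver L v) (hw : IsCMField.complexConj L • w.1 = w.1)
    (hH : (H.map (cmConjRingHom L))ᵀ = H) (hHd : IsUnit H.det)
    (T : GL (Fin 3) (UnitaryGroup.LocalRing L v)) {a : UnitaryGroup.LocalRing L v} (ha : IsUnit a)
    (haσ : conjLocal L (IsCMField.complexConj L) v a = a)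
    (h : formCongr (conjLocal L (IsCMField.complexConj L) v) T (H.map (algebraMap L (UnitaryGroup.LocalRing L v))) =
      a • (Matrix.of fun i j : Fin 3 => if i.val + j.val + 1 = 3 then (1 : L) else 0).map (algebraMap L (UnitaryGroup.LocalRing L v)))
    [MeasurableSpace ((UnitaryGroup.cmDatum L 3 H).Local v)] [BorelSpace ((UnitaryGroup.cmDatum L 3 H).Local v)]
    [MeasurableSpace ((UnitaryGroup.cmDatum L 3 (Matrix.of fun i j : Fin 3 => if i.val + j.val + 1 = 3 then (1 : L) else 0)).Local v)]
    [BorelSpace ((UnitaryGroup.cmDatum L 3 (Matrix.of fun i j : Fin 3 => if i.val + j.val + 1 = 3 then (1 : L) else 0)).Local v)]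
    [∀ γ : (UnitaryGroup.cmDatum L 3 H).Local v, MeasurableSpace (((UnitaryGroup.cmDatum L 3 H).Local v) ⧸ Subgroup.centralizer ({γ} : Set ((UnitaryGroup.cmDatum L 3 H).Local v)))]
    [∀ γ : (UnitaryGroup.cmDatum L 3 H).Local v, BorelSpace (((UnitaryGroup.cmDatum L 3 H).Local v) ⧸ Subgroup.centralizer ({γ} : Set ((UnitaryGroup.cmDatum L 3 H).Local v)))]
    [∀ γ : (UnitaryGroup.cmDatum L 3 (Matrix.of fun i j : Fin 3 => if i.val + j.val + 1 = 3 then (1 : L) else 0)).Local v,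
      MeasurableSpace (((UnitaryGroup.cmDatum L 3 (Matrix.of fun i j : Fin 3 => if i.val + j.val + 1 = 3 then (1 : L) else 0)).Local v) ⧸
        Subgroup.centralizer ({γ} : Set ((UnitaryGroup.cmDatum L 3 (Matrix.of fun i j : Fin 3 => if i.val + j.val + 1 = 3 then (1 : L) else 0)).Local v)))]
    [∀ γ : (UnitaryGroup.cmDatum L 3 (Matrix.of fun i j : Fin 3 => if i.val + j.val + 1 = 3 then (1 : L) else 0)).Local v,
      BorelSpace (((UnitaryGroup.cmDatum L 3 (Matrix.of fun i j : Fin 3 => if i.val + j.val + 1 = 3 then (1 : L) else 0)).Local v) ⧸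
        Subgroup.centralizer ({γ} : Set ((UnitaryGroup.cmDatum L 3 (Matrix.of fun i j : Fin 3 => if i.val + j.val + 1 = 3 then (1 : L) else 0)).Local v)))]
    [MeasurableSpace ((UnitaryGroup.cmDatum L 2 (Matrix.of fun i j : Fin 2 => if i.val + j.val + 1 = 2 then (1 : L) else 0)).Local v ×
      (UnitaryGroup.cmDatum L 1 (Matrix.of fun i j : Fin 1 => if i.val + j.val + 1 = 1 then (1 : L) else 0)).Local v)]
    [∀ a' : (UnitaryGroup.cmDatum L 2 (Matrix.of fun i j : Fin 2 => if i.val + j.val + 1 = 2 then (1 : L) else 0)).Local v ×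
        (UnitaryGroup.cmDatum L 1 (Matrix.of fun i j : Fin 1 => if i.val + j.val + 1 = 1 then (1 : L) else 0)).Local v,
      MeasurableSpace (((UnitaryGroup.cmDatum L 2 (Matrix.of fun i j : Fin 2 => if i.val + j.val + 1 = 2 then (1 : L) else 0)).Local v ×
          (UnitaryGroup.cmDatum L 1 (Matrix.of fun i j : Fin 1 => if i.val + j.val + 1 = 1 then (1 : L) else 0)).Local v) ⧸
        Subgroup.centralizer ({a'} : Set ((UnitaryGroup.cmDatum L 2 (Matrix.of fun i j : Fin 2 => if i.val + j.val + 1 = 2 then (1 : L) else 0)).Local v ×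
          (UnitaryGroup.cmDatum L 1 (Matrix.of fun i j : Fin 1 => if i.val + j.val + 1 = 1 then (1 : L) else 0)).Local v)))]
    (mHv : OrbitalMeasureFamily ((UnitaryGroup.cmDatum L 2 (Matrix.of fun i j : Fin 2 => if i.val + j.val + 1 = 2 then (1 : L) else 0)).Local v ×
      (UnitaryGroup.cmDatum L 1 (Matrix.of fun i j : Fin 1 => if i.val + j.val + 1 = 1 then (1 : L) else 0)).Local v))
    (mGv : OrbitalMeasureFamily ((UnitaryGroup.cmDatum L 3 H).Local v))
    (νG : Measure ((UnitaryGroup.cmDatum L 3 H).Local v)) [νG.IsHaarMeasure]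
    (νH : Measure ((UnitaryGroup.cmDatum L 2 (Matrix.of fun i j : Fin 2 => if i.val + j.val + 1 = 2 then (1 : L) else 0)).Local v ×
      (UnitaryGroup.cmDatum L 1 (Matrix.of fun i j : Fin 1 => if i.val + j.val + 1 = 1 then (1 : L) else 0)).Local v))
    (ξv : (UnitaryGroup.cmDatum L 2 (Matrix.of fun i j : Fin 2 => if i.val + j.val + 1 = 2 then (1 : L) else 0)).Local v ×
      (UnitaryGroup.cmDatum L 1 (Matrix.of fun i j : Fin 1 => if i.val + j.val + 1 = 1 then (1 : L) else 0)).Local v →* ℂˣ)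
    (ε : ℂ) (πn πs : IrrClass ((UnitaryGroup.cmDatum L 3 H).Local v))
    (hid : (⟨πn, some πs⟩ : CMLocalAPacket L H v).CharIdentityAtTest L H v (fun c f => ε * c.smoothTrace νG f) ξv νH
      ((finExplicitCollection L H μ (finExplicitDelta_conj_left_all L H μ) (finExplicitDelta_conj_right_all L H μ)) v) mHv mGv) :
    (⟨IrrClass.comap (cmDatumLocalCongr L v T ha h) πn, some (IrrClass.comap (cmDatumLocalCongr L v T ha h) πs)⟩ :
        CMLocalAPacket L (Matrix.of fun i j : Fin 3 => if i.val + j.val + 1 = 3 then (1 : L) else 0) v).CharIdentityAtTest L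
      (Matrix.of fun i j : Fin 3 => if i.val + j.val + 1 = 3 then (1 : L) else 0) v
      (fun c f => ((((if ∃ z : UnitaryGroup.LocalRing L v, IsUnit z ∧ a = z * UnitaryGroup.conjLocal L (IsCMField.complexConj L) v z then (1 : ℤ) else -1 : ℤ) : ℂ)) * ε) *
        c.smoothTrace (νG.map (cmDatumLocalCongr L v T ha h).symm) f)
      ξv νH
      ((finExplicitCollection L (Matrix.of fun i j : Fin 3 => if i.val + j.val + 1 = 3 then (1 : L) else 0) μ
        (finExplicitDelta_conj_left_all L (Matrix.of fun i j : Fin 3 => if i.val + j.val + 1 = 3 then (1 : L) else 0) μ)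
        (finExplicitDelta_conj_right_all L (Matrix.of fun i j : Fin 3 => if i.val + j.val + 1 = 3 then (1 : L) else 0) μ)) v) mHv
      (mGv.transport (cmDatumLocalCongr L v T ha h).symm.toMulEquiv (cmDatumLocalCongr L v T ha h).symm.continuous (cmDatumLocalCongr L v T ha h).continuous) := by
  set e := cmDatumLocalCongr L v T ha h with he_def
  set χ : ℂ := (((if ∃ z : UnitaryGroup.LocalRing L v, IsUnit z ∧ a = z * UnitaryGroup.conjLocal L (IsCMField.complexConj L) v z then (1 : ℤ) else -1 : ℤ) : ℂ))
    with hχ_def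
  have hχχ : χ * χ = 1 := by
    rw [hχ_def]; split_ifs <;> norm_num
  rw [LocalAPacket.charIdentityAtTest_pair_iff] at hid ⊢
  intro gH φ hgH hφ hmQ
  have hf : IsLocSmooth (φ ∘ e.symm) := F0P3cStCharTSTransport.isLocSmooth_comp_continuousMulEquiv e.symm hφ
  have hfH : IsLocSmooth (χ • gH) := hgH.const_smul χ
  have hφe : (φ ∘ e.symm) ∘ e = φ := by
    funext q
    simp only [Function.comp_apply, ContinuousMulEquiv.symm_apply_apply]
  have hmG : IsLocalDeltaTransfer L H v ((finExplicitCollection L H μ (finExplicitDelta_conj_left_all L H μ) (finExplicitDelta_conj_right_all L H μ)) v)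
      mHv mGv (χ • gH) (φ ∘ e.symm) := by
    rw [F0P3cStCharTSOfQuasiSplit.isLocalDeltaTransfer_iff_of_formCongr L H μ v w hw hH hHd.ne_zero T ha haσ h mHv mGv (χ • gH) (φ ∘ e.symm),
      smul_smul, hχχ, one_smul, hφe]
    exact hmQ
  have key := hid (χ • gH) (φ ∘ e.symm) hfH hf hmG
  rw [charDist_smul] at key
  have hadm_n : πn.IsAdmissible := F0P3LocalIrrepAdmissibleThree.localIrrepAdmissible_three_all L H hH hHd v πn
  have hadm_s : πs.IsAdmissible := F0P3LocalIrrepAdmissibleThree.localIrrepAdmissible_three_all L H hH hHd v πs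
  rw [← smoothTrace_comap_map_symm e πn hadm_n νG φ, ← smoothTrace_comap_map_symm e πs hadm_s νG φ] at key
  have hsolve : charDist ξv νH gH = χ * (ε * (IrrClass.comap e πn).smoothTrace (νG.map e.symm) φ + ε * (IrrClass.comap e πs).smoothTrace (νG.map e.symm) φ) := by
    have h1 : χ * (χ * charDist ξv νH gH) =
        χ * (ε * (IrrClass.comap e πn).smoothTrace (νG.map e.symm) φ + ε * (IrrClass.comap e πs).smoothTrace (νG.map e.symm) φ) :=
      congrArg (fun z => χ * z) key
    rw [← mul_assoc, hχχ, one_mul] at h1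
    exact h1
  rw [hsolve]
  ring

end Pair

end Summit.HodgeConjecture.HodgeConjecture.R90.S9

end
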